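import Summits.CriticalPhenomena.PercolationContinuityZ3.Theorems.PercNearOneGluingNoHeavyQuantURPMLift
import Summits.CriticalPhenomena.PercolationContinuityZ3.Theorems.PercNearOneGluingNoHeavyQuantForestData
import HarnessLib

/-!
# QUANT lane R8, T-DEC: the U-term root-pattern mixture AT LAW LEVEL, every width — generating polynomials of count laws, the CANONICAL
# root-pattern expansion of the forest law `flaw`, and `q₁·Σ_E w_E·flaw(L|_E^{o^E}) = flaw L − (1−q₁)δ₀` (census-1 gen 25)

builds on p205010 (kernel theorem, internal audit signed; external expert review pending)

Support file (`--supports stmt-CriticalPhenomena-4575`), QUANT lane seat prim-quant-census-1 (gen 25); memo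
`run/shared/lean/prim/quant/prim-quant-census-1/g25/URPM-G25.md`.  Third file of the U-RPM chain: ✓ p492829 `…QuantURPMIdentity` (closed-form weights
`urpmW`, Hurwitz-type identity, pattern identities), ✓ p493488 `…QuantURPMLift` (`urpm_lift`: the mixture identity for ANY pattern-to-law
assignment `X`).  Small `def`s + theorems, standard axioms, no sorries.  Uses typer g39's list binder (`…QuantForestData`: `Sib`, `flaw`, `ftop`,
`fmean`; `gate`, `lconv` of `…QuantSDEC`).

WHAT.  (§A) GENERATING POLYNOMIALS: `lawPoly M μ = Σ_{h≤M} μ(h)X^h` (Mathlib `Polynomial ℝ`); `coeff_lawPoly`; gating is affine and convolution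
is multiplication (`lawPoly_gate`, `lawPoly_lconv`); hence `lawPoly (ftop L) (flaw L) = Π_{s∈L} (q_s·P_{ρ_s} + (1 − q_s))` (`lawPoly_flaw`,
`sibPoly`) and `flaw L` is its coefficient sequence (`flaw_eq_coeff`, `flaw_eq_zero_of_lt`).  (§B) THE CANONICAL ROOT-PATTERN EXPANSION, indexed
by sets `A` of POSITIONS `Fin L.length` (the tree so far had it only existentially, `flaw_rootPattern` of `…QuantRootPatternRegating`):
`flaw L = Σ_A (Π_{i∈A} qᵢ·Π_{i∉A}(1 − qᵢ))·X_A` (`flaw_pattern`) with the PATTERN LAWS `X_A = patLaw L A` = coefficients of `Π_{i∈A} P_{ρᵢ}` (the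
law of the sum of the opened sub-forests at `A`; `patLaw_empty = δ₀`), by `Finset.prod_add`; and for the RE-GATED SUB-FOREST `subRegate L E o`
(the siblings at the positions `E`, root gates replaced by `o i`, the others absent; `regate`, `mem_subRegate`) the SAME pattern laws:
`flaw (L|_E^o) = Σ_{A⊆E} (Π_{i∈A} oᵢ·Π_{i∈E∖A}(1 − oᵢ))·X_A` (`flaw_subRegate`).  (§C) With shares `cᵢ = qᵢmᵢ/fmean L` (`share`; `asum_share_univ`),
relative gates `lᵢ = qᵢ/q₁` (`lrel`) and proportional openness `o^E_i = lᵢ/s_E` (`openE`), `urpm_lift` with `X := patLaw L` gives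
**`upart_rootPattern_mixture`**: for every non-empty `L` with `qᵢ, mean ρᵢ > 0`, every `q₁ ≠ 0`, every `h`:
  `q₁ · Σ_{∅≠E} urpmW q₁ c E · flaw (subRegate L E o^E) h = flaw L h − (1 − q₁)·δ₀(h)`,
i.e. arm-1 g52's opened compound `H = (flaw L′ − (1 − q)δ₀)/q` (the inner law of the U-part `gate_{aq}(ρ ∗ H)` of ✓ p486817 `gate_flaw_cons_eq_recursion`)
IS the `w`-mixture of the laws of the re-gated sub-forests `L′|_E^{o^E}`, for EVERY width, with the nonnegative closed-form weights of `…QuantURPMIdentity`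
(`urpmW_nonneg`, `urpm_total`); `openE_le_one` (balance `fmean L ≤ q₁·min mᵢ` ⟹ `o^E_i ≤ 1`) and `lrel_le_openE` (`o^E_i ≥ qᵢ/q₁`: with the outer
gate `a·q₁` of the U-part each re-gated sibling keeps at least its original openness `a·qᵢ`, so sub-forest floors are respected).
WHAT REMAINS for the width-`k` heavy-single balanced sibling step (architect/typer): the members of `subRegate L E o^E` are `TreeOK` when the
originals are and `o^E_i ∈ (0,1]` (fields `x₁, n, M, ρ` unchanged), so each `gate_{aq₁}(ρ ∗ flaw(L′|_E))` is an oracle call exactly as V, V₁, V₂ of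
✓ p485371; then `decAtT_mixture` along `urpm_total`/`urpmW_nonneg` and ✓ p487332/p487604 `decAt_resid_cons_of_upart(_oracle)`.
HONEST STATUS: algebra of laws only; `LightResidDECOracle`, `SiblingStep`, `GateStepN`, `FarTreeRow` OPEN; RATE class log\* / honest sentence of
`run/shared/lean/prim/quant/README.md` unchanged.  [this work]; setting and recursion: prim-quant-arm-1 g52; list binder: prim-quant-stmt g39.
Nothing here is cited as a published result.  The gluing rows served [cite: KozmaNitzan2024, Conjecture 3 (p. 15)]; product measure
[cite: Grimmett1999, §1.3 p. 10].
-/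

noncomputable section

open Polynomial Finset
open scoped BigOperators

namespace Summit.CriticalPhenomena.PercolationContinuityZ3.Theorems
namespace Quant
namespace LawDec

/-! ### §A Generating polynomials of count laws -/

/-- the generating polynomial `Σ_{h ≤ M} μ(h)·X^h` of a law on `{0..M}`. [this work] -/
def lawPoly (M : ℕ) (μ : ℕ → ℝ) : ℝ[X] := ∑ h ∈ Finset.range (M + 1), C (μ h) * X ^ h

/-- coefficients of the generating polynomial. [this work] -/
theorem coeff_lawPoly (M : ℕ) (μ : ℕ → ℝ) (n : ℕ) : (lawPoly M μ).coeff n = if n ≤ M then μ n else 0 := by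
  unfold lawPoly
  rw [finsetSum_coeff]
  simp_rw [coeff_C_mul_X_pow]
  rw [Finset.sum_ite_eq]
  simp only [Finset.mem_range, Nat.lt_succ_iff]

/-- gating is affine on generating polynomials: `P_{gate μ q} = q·P_μ + (1 − q)`. [this work] -/
theorem lawPoly_gate (M : ℕ) (μ : ℕ → ℝ) (q : ℝ) : lawPoly M (gate μ q) = C q * lawPoly M μ + C (1 - q) := by
  unfold lawPoly
  have e : ∀ h ∈ Finset.range (M + 1), C (gate μ q h) * X ^ h =
      C q * (C (μ h) * X ^ h) + (if h = 0 then C (1 - q) else 0) := by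
    intro h _
    rw [gate]
    by_cases h0 : h = 0
    · subst h0; simp only [if_true, pow_zero, mul_one, map_add, map_mul]
    · rw [if_neg h0, if_neg h0, add_zero, map_mul, mul_assoc, add_zero]
  rw [Finset.sum_congr rfl e, Finset.sum_add_distrib, ← Finset.mul_sum, Finset.sum_ite_eq' (Finset.range (M + 1)) 0,
    if_pos (Finset.mem_range.2 (Nat.succ_pos M))]

/-- convolution is multiplication of generating polynomials. [this work] -/
theorem lawPoly_lconv (M₁ M₂ : ℕ) (μ₁ μ₂ : ℕ → ℝ) :
    lawPoly (M₁ + M₂) (lconv M₁ M₂ μ₁ μ₂) = lawPoly M₁ μ₁ * lawPoly M₂ μ₂ := by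
  unfold lawPoly lconv
  rw [Finset.sum_mul_sum]
  -- right side: Σ_i Σ_k C(μ₁ i μ₂ k) X^{i+k}; left side: Σ_h Σ_i Σ_k [i+k=h] C(μ₁ i μ₂ k) X^h
  have lhs : ∀ h ∈ Finset.range (M₁ + M₂ + 1),
      C (∑ i ∈ Finset.range (M₁ + 1), ∑ k ∈ Finset.range (M₂ + 1), if i + k = h then μ₁ i * μ₂ k else 0) * X ^ h =
        ∑ i ∈ Finset.range (M₁ + 1), ∑ k ∈ Finset.range (M₂ + 1), (if i + k = h then C (μ₁ i * μ₂ k) * X ^ h else 0) := by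
    intro h _
    rw [map_sum, Finset.sum_mul]
    refine Finset.sum_congr rfl fun i _ => ?_
    rw [map_sum, Finset.sum_mul]
    refine Finset.sum_congr rfl fun k _ => ?_
    split_ifs with hik
    · rfl
    · rw [map_zero, zero_mul]
  rw [Finset.sum_congr rfl lhs, Finset.sum_comm]
  refine Finset.sum_congr rfl fun i hi => ?_
  rw [Finset.sum_comm]
  refine Finset.sum_congr rfl fun k hk => ?_
  have hik : i + k ∈ Finset.range (M₁ + M₂ + 1) := by
    simp only [Finset.mem_range] at hi hk ⊢; omega
  rw [Finset.sum_ite_eq (Finset.range (M₁ + M₂ + 1)) (i + k) (fun h => C (μ₁ i * μ₂ k) * X ^ h), if_pos hik, map_mul, pow_add]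
  ring

/-- the generating polynomial of one gated sibling `gate ρ q`: `q·P_ρ + (1 − q)`. [this work] -/
def sibPoly (s : Sib) : ℝ[X] := C s.q * lawPoly s.M s.ρ + C (1 - s.q)

/-- **the forest law's generating polynomial is the product of the siblings' polynomials.** [this work] -/
theorem lawPoly_flaw : ∀ L : List Sib, lawPoly (ftop L) (flaw L) = (L.map sibPoly).prod
  | [] => by
    unfold lawPoly
    simp [ftop, flaw]
  | s :: L => by
    rw [List.map_cons, List.prod_cons, ← lawPoly_flaw L]
    show lawPoly (ftop L + s.M) (lconv (ftop L) s.M (flaw L) (gate s.ρ s.q)) = sibPoly s * lawPoly (ftop L) (flaw L)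
    rw [lawPoly_lconv, lawPoly_gate, sibPoly, mul_comm]

/-- the forest law vanishes above its top. [this work] -/
theorem flaw_eq_zero_of_lt : ∀ (L : List Sib) (h : ℕ), ftop L < h → flaw L h = 0
  | [], h, hh => by simp only [flaw]; rw [if_neg (by simp [ftop] at hh; omega)]
  | s :: L, h, hh => lconv_eq_zero _ _ _ _ h hh

/-- the forest law is the coefficient sequence of its generating polynomial. [this work] -/
theorem flaw_eq_coeff (L : List Sib) (h : ℕ) : flaw L h = (lawPoly (ftop L) (flaw L)).coeff h := by
  rw [coeff_lawPoly]
  split_ifs with hh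
  · rfl
  · exact flaw_eq_zero_of_lt L h (not_le.1 hh)

/-- a list product as a product over positions. [this work] -/
theorem prod_map_eq_prod_get {β : Type*} [CommMonoid β] (f : Sib → β) :
    ∀ L : List Sib, (L.map f).prod = ∏ i : Fin L.length, f (L.get i)
  | [] => by simp
  | s :: L => by
    rw [List.map_cons, List.prod_cons, prod_map_eq_prod_get f L]
    simp [Fin.prod_univ_succ]

/-! ### §B The root-pattern expansion, canonically indexed by sets of positions -/

/-- **the pattern law** `X_A`: the law of the sum of the OPENED sub-forests at the positions `A` (coefficients of `Π_{i∈A} P_{ρᵢ}`). [this work] -/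
def patLaw (L : List Sib) (A : Finset (Fin L.length)) : ℕ → ℝ :=
  fun h => (∏ i ∈ A, lawPoly (L.get i).M (L.get i).ρ).coeff h

/-- expanding a product of re-gated sibling polynomials over the open-root sets. [this work] -/
theorem prod_regate_expand (L : List Sib) (g : Fin L.length → ℝ) (E : Finset (Fin L.length)) :
    ∏ i ∈ E, (C (g i) * lawPoly (L.get i).M (L.get i).ρ + C (1 - g i)) =
      ∑ A ∈ E.powerset, C ((∏ i ∈ A, g i) * ∏ i ∈ E \ A, (1 - g i)) * ∏ i ∈ A, lawPoly (L.get i).M (L.get i).ρ := by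
  rw [Finset.prod_add]
  refine Finset.sum_congr rfl fun A _ => ?_
  rw [Finset.prod_mul_distrib, map_mul, map_prod, map_prod]
  ring

/-- **THE ROOT-PATTERN EXPANSION OF THE FOREST LAW**, canonically indexed:
`flaw L = Σ_{A ⊆ positions} (Π_{i∈A} qᵢ · Π_{i∉A} (1 − qᵢ)) · X_A`. [this work] -/
theorem flaw_pattern (L : List Sib) (h : ℕ) :
    flaw L h = ∑ A ∈ (Finset.univ : Finset (Fin L.length)).powerset,
      ((∏ i ∈ A, (L.get i).q) * ∏ i ∈ Finset.univ \ A, (1 - (L.get i).q)) * patLaw L A h := by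
  rw [flaw_eq_coeff, lawPoly_flaw, prod_map_eq_prod_get]
  have e : ∏ i : Fin L.length, sibPoly (L.get i) =
      ∏ i ∈ (Finset.univ : Finset (Fin L.length)), (C ((fun i => (L.get i).q) i) * lawPoly (L.get i).M (L.get i).ρ +
        C (1 - (fun i => (L.get i).q) i)) := rfl
  rw [e, prod_regate_expand, finsetSum_coeff]
  refine Finset.sum_congr rfl fun A _ => ?_
  rw [coeff_C_mul]
  rfl

/-- re-gating a sibling: the same sub-forest under the root gate `o`. [this work] -/
def regate (s : Sib) (o : ℝ) : Sib := ⟨o, s.x₁, s.n, s.M, s.ρ⟩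

/-- **the re-gated sub-forest** on the position set `E` with root gates `o`: the siblings of `L` at the positions of `E` (in increasing
order), each under the gate `o i`, the others absent. [this work] -/
def subRegate (L : List Sib) (E : Finset (Fin L.length)) (o : Fin L.length → ℝ) : List Sib :=
  (E.sort (· ≤ ·)).map fun i => regate (L.get i) (o i)

/-- the members of the re-gated sub-forest. [this work] -/
theorem mem_subRegate (L : List Sib) (E : Finset (Fin L.length)) (o : Fin L.length → ℝ) (s : Sib) :
    s ∈ subRegate L E o ↔ ∃ i ∈ E, s = regate (L.get i) (o i) := by
  unfold subRegate
  simp only [List.mem_map, Finset.mem_sort]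
  exact ⟨fun ⟨i, hi, h⟩ => ⟨i, hi, h.symm⟩, fun ⟨i, hi, h⟩ => ⟨i, hi, h.symm⟩⟩

/-- **the law of the re-gated sub-forest**: `flaw (L|_E^o) = Σ_{A ⊆ E} (Π_{i∈A} oᵢ · Π_{i∈E∖A} (1 − oᵢ)) · X_A` — the SAME pattern laws. [this work] -/
theorem flaw_subRegate (L : List Sib) (E : Finset (Fin L.length)) (o : Fin L.length → ℝ) (h : ℕ) :
    flaw (subRegate L E o) h = ∑ A ∈ E.powerset, ((∏ i ∈ A, o i) * ∏ i ∈ E \ A, (1 - o i)) * patLaw L A h := by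
  rw [flaw_eq_coeff, lawPoly_flaw]
  unfold subRegate
  rw [List.map_map, ← List.prod_toFinset _ (Finset.sort_nodup _ _), Finset.sort_toFinset]
  have e : ∏ i ∈ E, (sibPoly ∘ fun i => regate (L.get i) (o i)) i =
      ∏ i ∈ E, (C (o i) * lawPoly (L.get i).M (L.get i).ρ + C (1 - o i)) := rfl
  rw [e, prod_regate_expand, finsetSum_coeff]
  refine Finset.sum_congr rfl fun A _ => ?_
  rw [coeff_C_mul]
  rfl

/-- the empty pattern law is `δ₀`. [this work] -/
theorem patLaw_empty (L : List Sib) (h : ℕ) : patLaw L ∅ h = if h = 0 then 1 else 0 := by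
  unfold patLaw
  rw [Finset.prod_empty, coeff_one]

/-- `fmean` as a sum over positions. [this work] -/
theorem fmean_eq_sum_get : ∀ L : List Sib, fmean L = ∑ i : Fin L.length, (L.get i).q * (L.get i).mean
  | [] => by simp [fmean]
  | s :: L => by
    rw [show fmean (s :: L) = fmean L + s.q * s.mean from rfl, fmean_eq_sum_get L]
    simp [Fin.sum_univ_succ, add_comm]

end LawDec

/-! ### §C The U-term root-pattern mixture at LAW level, every width -/

namespace URPM

open LawDec

/-- the mass share `c_i = q_i m_i / fmean L` of the sibling at position `i`. [this work] -/
def share (L : List Sib) (i : Fin L.length) : ℝ := (L.get i).q * (L.get i).mean / fmean L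

/-- the relative gate `l_i = q_i / q₁` (the root marginal of position `i` in the opened compound `H`). [this work] -/
def lrel (L : List Sib) (q₁ : ℝ) (i : Fin L.length) : ℝ := (L.get i).q / q₁

/-- the proportional openness `o^E_i = l_i / s_E` of the component `E`. [this work] -/
def openE (L : List Sib) (q₁ : ℝ) (E : Finset (Fin L.length)) (i : Fin L.length) : ℝ := lrel L q₁ i / asum (share L) E

/-- the shares sum to `1` (`fmean L ≠ 0`). [this work] -/
theorem asum_share_univ (L : List Sib) (hf : fmean L ≠ 0) : asum (share L) Finset.univ = 1 := by
  unfold asum share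
  rw [← Finset.sum_div, ← fmean_eq_sum_get, div_self hf]

/-- the law of the component `E` assembled from the pattern laws IS the law of the re-gated sub-forest `L|_E^{o^E}`. [this work] -/
theorem lawE_patLaw_eq_flaw_subRegate (L : List Sib) (q₁ : ℝ) (E : Finset (Fin L.length)) :
    lawE (share L) (lrel L q₁) (patLaw L) E = flaw (subRegate L E (openE L q₁ E)) := by
  funext h
  unfold lawE
  rw [Finset.sum_apply, flaw_subRegate]
  refine Finset.sum_congr rfl fun A _ => ?_
  rw [Pi.smul_apply, smul_eq_mul]
  rfl

/-- the product pattern weights of `(q₁, l)` are those of the list's own gates (`q₁ l_i = q_i`). [this work] -/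
theorem piP_lrel (L : List Sib) (q₁ : ℝ) (hq : q₁ ≠ 0) (A : Finset (Fin L.length)) :
    piP q₁ (lrel L q₁) Finset.univ A = (∏ i ∈ A, (L.get i).q) * ∏ i ∈ Finset.univ \ A, (1 - (L.get i).q) := by
  unfold piP lrel
  have e : ∀ i : Fin L.length, q₁ * ((L.get i).q / q₁) = (L.get i).q := fun i => mul_div_cancel₀ _ hq
  simp_rw [e]

/-- **THE U-TERM ROOT-PATTERN MIXTURE AT LAW LEVEL, EVERY WIDTH (ARCH-G52 §3.2 ⟸ `urpm_lift` + the pattern expansion).**  For a non-empty list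
`L` of siblings with `qᵢ > 0`, `mean ρᵢ > 0` and any `q₁ ≠ 0`:
`q₁ · Σ_{∅≠E⊆positions} w_E · flaw (L|_E^{o^E}) = flaw L − (1 − q₁)·δ₀`  pointwise — i.e. the opened compound `H = (flaw L − (1−q₁)δ₀)/q₁` is the
`w`-mixture of the laws of the re-gated sub-forests (`w_E = urpmW q₁ c` with the shares `c = share L`, all `≥ 0` for `0 ≤ q₁ ≤ 1`, total `1`:
`urpmW_nonneg`, `urpm_total`; openness `o^E_i = (qᵢ/q₁)/s_E ≤ 1` under the balance condition, `openE_le_one`). [this work] -/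
theorem upart_rootPattern_mixture (L : List Sib) (q₁ : ℝ) (hq : q₁ ≠ 0) (hL : L ≠ [])
    (hqpos : ∀ i : Fin L.length, 0 < (L.get i).q) (hmpos : ∀ i : Fin L.length, 0 < (L.get i).mean) (h : ℕ) :
    q₁ * ∑ E ∈ (Finset.univ : Finset (Fin L.length)).powerset.erase ∅,
        urpmW q₁ (share L) Finset.univ E * flaw (subRegate L E (openE L q₁ E)) h =
      flaw L h - (1 - q₁) * (if h = 0 then 1 else 0) := by
  have hk : 0 < L.length := List.length_pos_of_ne_nil hL
  have hR : (Finset.univ : Finset (Fin L.length)).Nonempty := Finset.univ_nonempty_iff.2 ⟨⟨0, hk⟩⟩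
  have hpos : ∀ i : Fin L.length, 0 < (L.get i).q * (L.get i).mean := fun i => mul_pos (hqpos i) (hmpos i)
  have hfm : 0 < fmean L := by
    rw [fmean_eq_sum_get]; exact Finset.sum_pos (fun i _ => hpos i) hR
  have hc : asum (share L) Finset.univ = 1 := asum_share_univ L (ne_of_gt hfm)
  have hcpos : ∀ i ∈ (Finset.univ : Finset (Fin L.length)), 0 < share L i := fun i _ => div_pos (hpos i) hfm
  have key := urpm_lift q₁ (share L) (lrel L q₁) Finset.univ hR hc hcpos (patLaw L)
  have key' := congrFun key h
  simp only [Pi.smul_apply, Finset.sum_apply, smul_eq_mul, Pi.sub_apply] at key'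
  rw [flaw_pattern L h, patLaw_empty] at *
  simp_rw [lawE_patLaw_eq_flaw_subRegate, piP_lrel L q₁ hq] at key'
  exact key'

/-- under the BALANCE condition `fmean L ≤ q₁·mean ρᵢ` for all `i` (i.e. `m* ≤ min mᵢ`), every openness is `≤ 1` (`q₁, qᵢ, mean ρᵢ > 0`).
[this work] -/
theorem openE_le_one (L : List Sib) (q₁ : ℝ) (hq : 0 < q₁) (hqpos : ∀ i : Fin L.length, 0 < (L.get i).q)
    (hmpos : ∀ i : Fin L.length, 0 < (L.get i).mean) (hbal : ∀ i : Fin L.length, fmean L ≤ q₁ * (L.get i).mean)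
    (E : Finset (Fin L.length)) {i : Fin L.length} (hi : i ∈ E) : openE L q₁ E i ≤ 1 := by
  have hpos : ∀ i : Fin L.length, 0 < (L.get i).q * (L.get i).mean := fun i => mul_pos (hqpos i) (hmpos i)
  have hfm : 0 < fmean L := by
    rw [fmean_eq_sum_get]; exact Finset.sum_pos (fun i _ => hpos i) ⟨i, Finset.mem_univ i⟩
  have hcpos : ∀ t, 0 < share L t := fun t => div_pos (hpos t) hfm
  unfold openE
  refine urpm_box (share L) (lrel L q₁) E (fun t _ => (hcpos t).le) (fun t _ => ?_) hi (Finset.sum_pos (fun t _ => hcpos t) ⟨i, hi⟩)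
  -- `l_t ≤ c_t` ⟺ `q_t/q₁ ≤ q_t m_t / fmean` ⟺ `fmean ≤ q₁ m_t`
  unfold lrel share
  rw [div_le_div_iff₀ hq hfm]
  nlinarith [hbal t, hqpos t]

/-- the openness is at least the relative gate: `o^E_i ≥ qᵢ/q₁` (`0 < s_E ≤ 1`): with `q₁ ≤ 1` a re-gated root is at least as open as
before, so the sub-forests' floors are respected. [this work] -/
theorem lrel_le_openE (L : List Sib) (q₁ : ℝ) (hq : 0 < q₁) (hqpos : ∀ i : Fin L.length, 0 < (L.get i).q)
    (hmpos : ∀ i : Fin L.length, 0 < (L.get i).mean) (E : Finset (Fin L.length)) {i : Fin L.length} (hi : i ∈ E) :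
    lrel L q₁ i ≤ openE L q₁ E i := by
  have hpos : ∀ i : Fin L.length, 0 < (L.get i).q * (L.get i).mean := fun i => mul_pos (hqpos i) (hmpos i)
  have hfm : 0 < fmean L := by
    rw [fmean_eq_sum_get]; exact Finset.sum_pos (fun i _ => hpos i) ⟨i, Finset.mem_univ i⟩
  have hcpos : ∀ t, 0 < share L t := fun t => div_pos (hpos t) hfm
  have hsE : 0 < asum (share L) E := Finset.sum_pos (fun t _ => hcpos t) ⟨i, hi⟩
  have hs1 : asum (share L) E ≤ 1 := by
    rw [← asum_share_univ L (ne_of_gt hfm)]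
    exact Finset.sum_le_sum_of_subset_of_nonneg (Finset.subset_univ E) fun t _ _ => (hcpos t).le
  have hl : 0 ≤ lrel L q₁ i := div_nonneg (hqpos i).le hq.le
  unfold openE
  exact (le_div_iff₀ hsE).2 (mul_le_of_le_one_right hl hs1)

end URPM

end Quant
end Summit.CriticalPhenomena.PercolationContinuityZ3.Theorems
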